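import Mathlib.Analysis.SpecialFunctions.ImproperIntegrals
import Mathlib.MeasureTheory.Integral.IntegralEqImproper
import Literature.NumberTheory.LFunctions.LagariasRains2003.Theta
import HarnessLib

/-!
# Lagarias–Rains (2003), Theorem 2.1 — the convergent representation of `Z_ℚ(w, s)`

For `Re w < Re s < 0` (the cone of absolute convergence of (1.5)), splitting the integral at
`t = 1`, substituting `t ↦ 1/t` on `(0, 1)` and using the transformation law `θ(1/t²) = t θ(t²)`
exactly as in the proof of [LagariasRains2003, Thm. 2.1] gives
`Z_ℚ(w, s) = ∫_1^∞ θ(t²)^w (t^{s−1} + t^{w−s−1}) dt = −1/s + 1/(s−w) + ∫_1^∞ (θ(t²)^w − 1)(t^{s−1} + t^{w−s−1}) dt`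
(their (2.9) is the same formula after `t = e^x`). The last integrand decays like `e^{−π t²}`, which
is what makes `Z_ℚ` computable (`LagariasRains2003.Refutation`).
-/

open MeasureTheory Set Filter Topology Complex

namespace Literature.NumberTheory.LFunctions.LagariasRains2003

variable {w s : ℂ}

/-- The integrand of (1.5). [cite: LagariasRains2003, (1.5)] -/
noncomputable def integrand (w s : ℂ) (t : ℝ) : ℂ :=
  ((theta (t ^ 2) : ℂ) ^ s * (theta (1 / t ^ 2) : ℂ) ^ (w - s)) / (t : ℂ)

/-- [cite: LagariasRains2003, (1.5)] -/
theorem ZQ_eq_integral_integrand : ZQ w s = ∫ t in Ioi (0 : ℝ), integrand w s t := rfl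

/-- On `t > 0`: `θ(t²)^s θ(1/t²)^{w−s}/t = t^{w−s−1} θ(t²)^w` (transformation law).
[cite: LagariasRains2003, proof of Thm. 2.1] -/
theorem integrand_eq {t : ℝ} (ht : 0 < t) :
    integrand w s t = (t : ℂ) ^ (w - s - 1) * (theta (t ^ 2) : ℂ) ^ w := by
  have hθ : 0 < theta (t ^ 2) := theta_pos (by positivity)
  have hθ0 : (theta (t ^ 2) : ℂ) ≠ 0 := ofReal_ne_zero.mpr hθ.ne'
  have ht0 : (t : ℂ) ≠ 0 := ofReal_ne_zero.mpr ht.ne'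
  unfold integrand
  rw [theta_one_div_sq ht, ofReal_mul, mul_cpow_ofReal_nonneg ht.le hθ.le,
    cpow_sub (w - s) 1 ht0, cpow_one,
    show (theta (t ^ 2) : ℂ) ^ w = (theta (t ^ 2) : ℂ) ^ s * (theta (t ^ 2) : ℂ) ^ (w - s) by
      rw [← cpow_add _ _ hθ0]; congr 1; ring]
  field_simp

/-- On `x > 0`: `x^{−2} · (θ((1/x)²)^s θ(x²)^{w−s} · x) = x^{s−1} θ(x²)^w` — the substituted
integrand. [cite: LagariasRains2003, proof of Thm. 2.1] -/
theorem integrand_inv_eq {x : ℝ} (hx : 0 < x) :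
    ((x ^ (-2 : ℝ) : ℝ) : ℂ) * integrand w s x⁻¹ = (x : ℂ) ^ (s - 1) * (theta (x ^ 2) : ℂ) ^ w := by
  have hθ : 0 < theta (x ^ 2) := theta_pos (by positivity)
  have hθ0 : (theta (x ^ 2) : ℂ) ≠ 0 := ofReal_ne_zero.mpr hθ.ne'
  have hx0 : (x : ℂ) ≠ 0 := ofReal_ne_zero.mpr hx.ne'
  unfold integrand
  have e1 : (x⁻¹) ^ 2 = 1 / x ^ 2 := by rw [inv_pow, one_div]
  have e2 : (1 : ℝ) / (1 / x ^ 2) = x ^ 2 := one_div_one_div (x ^ 2)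
  have e3 : (x ^ (-2 : ℝ) : ℝ) = (x ^ 2)⁻¹ := by
    rw [Real.rpow_neg hx.le, show (2 : ℝ) = ((2 : ℕ) : ℝ) by norm_num, Real.rpow_natCast]
  rw [e1, e2, e3, theta_one_div_sq hx, ofReal_mul, mul_cpow_ofReal_nonneg hx.le hθ.le,
    show (theta (x ^ 2) : ℂ) ^ w = (theta (x ^ 2) : ℂ) ^ s * (theta (x ^ 2) : ℂ) ^ (w - s) by
      rw [← cpow_add _ _ hθ0]; congr 1; ring,
    cpow_sub s 1 hx0, cpow_one, ofReal_inv]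
  push_cast
  field_simp

/-- `t ↦ θ(t²)^w` is continuous on `(0, ∞)`. [folklore] -/
private theorem continuousOn_thetaSq_cpow (w : ℂ) :
    ContinuousOn (fun t : ℝ => (theta (t ^ 2) : ℂ) ^ w) (Ioi 0) := by
  have h1 : ContinuousOn (fun t : ℝ => theta (t ^ 2)) (Ioi 0) :=
    continuousOn_theta.comp (continuous_pow 2).continuousOn (fun t ht => by
      simp only [mem_Ioi] at ht ⊢; positivity)
  have h2 : ContinuousOn (fun t : ℝ => (theta (t ^ 2) : ℂ)) (Ioi 0) :=
    continuous_ofReal.comp_continuousOn h1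
  exact h2.cpow continuousOn_const fun t ht =>
    ofReal_mem_slitPlane.mpr (theta_pos (by simp only [mem_Ioi] at ht; positivity))

/-- `|θ(t²)^w| ≤ 1` for `Re w ≤ 0`. [folklore] -/
private theorem norm_thetaSq_cpow_le {t : ℝ} (ht : 0 < t) (hw : w.re ≤ 0) :
    ‖(theta (t ^ 2) : ℂ) ^ w‖ ≤ 1 := by
  rw [norm_cpow_eq_rpow_re_of_pos (theta_pos (by positivity))]
  exact Real.rpow_le_one_of_one_le_of_nonpos (one_le_theta (by positivity)) hw

/-- `t ↦ t^a θ(t²)^w` is integrable on `(1, ∞)` for `Re a < −1`, `Re w ≤ 0`.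
[cite: LagariasRains2003, proof of Thm. 2.1] -/
theorem integrableOn_cpow_mul_thetaPow {a : ℂ} (ha : a.re < -1) (hw : w.re ≤ 0) :
    IntegrableOn (fun t : ℝ => (t : ℂ) ^ a * (theta (t ^ 2) : ℂ) ^ w) (Ioi 1) := by
  have hg : IntegrableOn (fun t : ℝ => (t : ℂ) ^ a) (Ioi 1) := integrableOn_Ioi_cpow_of_lt ha one_pos
  have hf : AEStronglyMeasurable (fun t : ℝ => (theta (t ^ 2) : ℂ) ^ w)
      (volume.restrict (Ioi 1)) :=
    ((continuousOn_thetaSq_cpow w).mono (Ioi_subset_Ioi zero_le_one)).aestronglyMeasurable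
      measurableSet_Ioi
  have hb : ∀ᵐ t ∂(volume.restrict (Ioi (1 : ℝ))), ‖(theta (t ^ 2) : ℂ) ^ w‖ ≤ 1 := by
    filter_upwards [ae_restrict_mem measurableSet_Ioi] with t ht
    exact norm_thetaSq_cpow_le (zero_lt_one.trans ht) hw
  exact hg.mul_bdd hf hb

/-- **Theorem 2.1, first form**: for `Re w < Re s < 0`,
`Z_ℚ(w, s) = ∫_1^∞ (t^{s−1} + t^{w−s−1}) θ(t²)^w dt`. [cite: LagariasRains2003, proof of Thm. 2.1] -/
theorem ZQ_eq_integral_Ioi_one (hws : w.re < s.re) (hs : s.re < 0) :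
    ZQ w s = ∫ t in Ioi (1 : ℝ),
      ((t : ℂ) ^ (s - 1) + (t : ℂ) ^ (w - s - 1)) * (theta (t ^ 2) : ℂ) ^ w := by
  have hw0 : w.re ≤ 0 := by linarith
  have ha1 : (s - 1).re < -1 := by simp; linarith
  have ha2 : (w - s - 1).re < -1 := by simp; linarith
  have hI1 := integrableOn_cpow_mul_thetaPow (w := w) ha1 hw0
  have hI2 := integrableOn_cpow_mul_thetaPow (w := w) ha2 hw0
  have hF2 : IntegrableOn (integrand w s) (Ioi 1) :=
    hI2.congr_fun (fun t ht => (integrand_eq (zero_lt_one.trans ht)).symm) measurableSet_Ioi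
  set H : ℝ → ℂ := fun x => ((x ^ (-2 : ℝ) : ℝ) : ℂ) * integrand w s x⁻¹ with hH
  have hHeq : EqOn H (fun t : ℝ => (t : ℂ) ^ (s - 1) * (theta (t ^ 2) : ℂ) ^ w) (Ioi 0) :=
    fun x hx => integrand_inv_eq hx
  have hHint : IntegrableOn H (Ioi 1) :=
    hI1.congr_fun (fun x hx => (hHeq (mem_Ioi.mpr (zero_lt_one.trans (mem_Ioi.mp hx)))).symm)
      measurableSet_Ioi
  have key_fun : EqOn (fun x : ℝ =>
      (|(-1 : ℝ)| * x ^ ((-1 : ℝ) - 1)) • (Ioc (0 : ℝ) 1).indicator (integrand w s) (x ^ (-1 : ℝ)))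
      ((Ici (1 : ℝ)).indicator H) (Ioi 0) := by
    intro x hx
    simp only [mem_Ioi] at hx
    have e1 : x ^ (-1 : ℝ) = x⁻¹ := Real.rpow_neg_one x
    have e2 : |(-1 : ℝ)| * x ^ ((-1 : ℝ) - 1) = x ^ (-2 : ℝ) := by norm_num
    simp only
    rw [e1, e2]
    by_cases h1 : 1 ≤ x
    · have hmem : x⁻¹ ∈ Ioc (0 : ℝ) 1 := ⟨inv_pos.mpr hx, (inv_le_one₀ hx).mpr h1⟩
      rw [indicator_of_mem hmem, indicator_of_mem (mem_Ici.mpr h1), hH]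
      simp only [real_smul]
    · have hnmem : x⁻¹ ∉ Ioc (0 : ℝ) 1 := fun h => h1 ((inv_le_one₀ hx).mp h.2)
      rw [indicator_of_notMem hnmem, indicator_of_notMem (by simpa using h1), smul_zero]
  have hsub := integral_comp_rpow_Ioi (g := (Ioc (0 : ℝ) 1).indicator (integrand w s))
    (p := (-1 : ℝ)) (by norm_num)
  rw [setIntegral_congr_fun measurableSet_Ioi key_fun, setIntegral_indicator measurableSet_Ici,
    setIntegral_indicator measurableSet_Ioc,
    show Ioi (0 : ℝ) ∩ Ici 1 = Ici 1 from inter_eq_right.mpr (Ici_subset_Ioi.mpr zero_lt_one),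
    show Ioi (0 : ℝ) ∩ Ioc 0 1 = Ioc 0 1 from inter_eq_right.mpr Ioc_subset_Ioi_self,
    integral_Ici_eq_integral_Ioi] at hsub
  have hF1 : IntegrableOn (integrand w s) (Ioc 0 1) := by
    have h := integrableOn_Ioi_comp_rpow_iff ((Ioc (0 : ℝ) 1).indicator (integrand w s))
      (p := (-1 : ℝ)) (by norm_num)
    have hL : IntegrableOn (fun x : ℝ =>
        (|(-1 : ℝ)| * x ^ ((-1 : ℝ) - 1)) • (Ioc (0 : ℝ) 1).indicator (integrand w s) (x ^ (-1 : ℝ)))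
        (Ioi 0) := by
      refine IntegrableOn.congr_fun ?_ key_fun.symm measurableSet_Ioi
      rw [IntegrableOn, integrable_indicator_iff measurableSet_Ici, IntegrableOn,
        Measure.restrict_restrict measurableSet_Ici,
        show Ici (1 : ℝ) ∩ Ioi 0 = Ici 1 from inter_eq_left.mpr (Ici_subset_Ioi.mpr zero_lt_one)]
      exact (integrableOn_Ici_iff_integrableOn_Ioi).mpr hHint
    have hR := h.mp hL
    rw [IntegrableOn, integrable_indicator_iff measurableSet_Ioc, IntegrableOn,
      Measure.restrict_restrict measurableSet_Ioc,
      show Ioc (0 : ℝ) 1 ∩ Ioi 0 = Ioc 0 1 from inter_eq_left.mpr Ioc_subset_Ioi_self] at hR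
    exact hR
  rw [ZQ_eq_integral_integrand, ← Ioc_union_Ioi_eq_Ioi zero_le_one,
    setIntegral_union Ioc_disjoint_Ioi_same measurableSet_Ioi hF1 hF2, ← hsub,
    setIntegral_congr_fun measurableSet_Ioi
      (fun x hx => hHeq (mem_Ioi.mpr (zero_lt_one.trans (mem_Ioi.mp hx)))),
    setIntegral_congr_fun measurableSet_Ioi
      (fun t ht => integrand_eq (w := w) (s := s) (zero_lt_one.trans ht)),
    ← integral_add hI1 hI2]
  congr 1
  ext t
  ring

/-- The integrand of the convergent representation is integrable on `(1, ∞)`.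
[cite: LagariasRains2003, proof of Thm. 2.1] -/
theorem integrableOn_thetaPowSubOne_mul (hws : w.re < s.re) (hs : s.re < 0) :
    IntegrableOn (fun t : ℝ =>
      ((theta (t ^ 2) : ℂ) ^ w - 1) * ((t : ℂ) ^ (s - 1) + (t : ℂ) ^ (w - s - 1))) (Ioi 1) := by
  have hw0 : w.re ≤ 0 := by linarith
  have ha1 : (s - 1).re < -1 := by simp; linarith
  have ha2 : (w - s - 1).re < -1 := by simp; linarith
  have hI1 := integrableOn_cpow_mul_thetaPow (w := w) ha1 hw0
  have hI2 := integrableOn_cpow_mul_thetaPow (w := w) ha2 hw0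
  have hc1 := integrableOn_Ioi_cpow_of_lt ha1 one_pos
  have hc2 := integrableOn_Ioi_cpow_of_lt ha2 one_pos
  have := (hI1.add hI2).sub (hc1.add hc2)
  refine this.congr_fun (fun t _ => ?_) measurableSet_Ioi
  simp only [Pi.add_apply, Pi.sub_apply]
  ring

/-- **Theorem 2.1 / (2.9)**: for `Re w < Re s < 0`,
`Z_ℚ(w, s) = −1/s + 1/(s − w) + ∫_1^∞ (θ(t²)^w − 1)(t^{s−1} + t^{w−s−1}) dt`.
[cite: LagariasRains2003, Thm. 2.1 / (2.9)] -/
theorem ZQ_eq (hws : w.re < s.re) (hs : s.re < 0) :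
    ZQ w s = -1 / s + 1 / (s - w) +
      ∫ t in Ioi (1 : ℝ), ((theta (t ^ 2) : ℂ) ^ w - 1) * ((t : ℂ) ^ (s - 1) + (t : ℂ) ^ (w - s - 1)) := by
  have hw0 : w.re ≤ 0 := by linarith
  have ha1 : (s - 1).re < -1 := by simp; linarith
  have ha2 : (w - s - 1).re < -1 := by simp; linarith
  have hc1 := integrableOn_Ioi_cpow_of_lt ha1 one_pos
  have hc2 := integrableOn_Ioi_cpow_of_lt ha2 one_pos
  have hc12 : IntegrableOn (fun t : ℝ => (t : ℂ) ^ (s - 1) + (t : ℂ) ^ (w - s - 1)) (Ioi 1) :=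
    hc1.add hc2
  have h3 := integrableOn_thetaPowSubOne_mul hws hs
  have hne : w - s ≠ 0 := by
    intro h
    have := congrArg Complex.re h
    simp at this
    linarith
  have hne' : s - w ≠ 0 := fun h => hne (by rw [← neg_sub, h, neg_zero])
  have e1 : ∫ t in Ioi (1 : ℝ), (t : ℂ) ^ (s - 1) = -1 / s := by
    rw [integral_Ioi_cpow_of_lt ha1 one_pos, show s - 1 + 1 = s by ring, ofReal_one, one_cpow]
  have e2 : ∫ t in Ioi (1 : ℝ), (t : ℂ) ^ (w - s - 1) = 1 / (s - w) := by
    rw [integral_Ioi_cpow_of_lt ha2 one_pos, show w - s - 1 + 1 = w - s by ring, ofReal_one,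
      one_cpow]
    field_simp
    ring
  have hsplit : (fun t : ℝ => ((t : ℂ) ^ (s - 1) + (t : ℂ) ^ (w - s - 1)) * (theta (t ^ 2) : ℂ) ^ w)
      = fun t => (((theta (t ^ 2) : ℂ) ^ w - 1) * ((t : ℂ) ^ (s - 1) + (t : ℂ) ^ (w - s - 1))) +
          ((t : ℂ) ^ (s - 1) + (t : ℂ) ^ (w - s - 1)) := by
    ext t; ring
  rw [ZQ_eq_integral_Ioi_one hws hs, hsplit, integral_add h3 hc12, integral_add hc1 hc2,
    e1, e2]
  ring

end Literature.NumberTheory.LFunctions.LagariasRains2003
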